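import Summits.AtomisticToContinuum.BoseEinsteinCondensation.Theorems.BECInsertionCorrectorStaticResponseBoundFewBodyFinal
import HarnessLib

/-!
# The few-body half of the static response bound, quintic window: assembly of `FewBodyBounded5`
# (registered stub `stub_fewBodyBounded5_of_allCouplingPT`, line `stable-fraction-square-completion`, seat a1 layer;
# item stmt-AtomisticToContinuum-12057 — this file supports, does not close, the item)

For every BOUNDED admissible pair potential `w`, every `N`, `L > 0` in the few-body regime `E₀(w,N,L)·L² ≤ 4π²/5`
(no factor `N`), every `k ≠ 0`, every coupling `t` and every finite-energy periodic trial state `Ψ`: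

  `E₀(w,N,L) − 14 t² N/|p|² ≤ E_w(Ψ) + t ⟨∑ⱼ cos(p·xⱼ)⟩_Ψ`,

from the all-coupling one-component second-order perturbation theory (registered stub `stub_allCouplingPT`, text
inlined as the hypothesis), the LANDED complex ground-state representation (`stub_complexGsRep`) and the LANDED
weighted gap (`stub_weightedGap`).

Proof. `N = 0` is trivial (`⟨V⟩ = 0`, `E₀ ≤ E_w(Ψ)`). For `N ≥ 1` take the positive `C¹` ground state `Φ` of the
bounded potential (`boundedPositiveMinimiser_holds`), replaced by its half-wavelength translate if necessary so that
`t⟨V⟩_Φ ≥ 0` (`exists_translate_cosMean_eq_neg`); `λ = E₀`, and `λ L² ≤ 4π²/5` gives `5λ ≤ (2π/L)²`.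
Write `Ψ = (θ₁ + iθ₂)|Φ|`; by the complex ground-state representation
`E_w(Ψ) + t⟨V⟩_Ψ − λ = ∑ᵢ [𝓔(θᵢ) + t∫Vθᵢ²|Φ|²]`, and each bracket is `≥ −14t²(N/|p|²)∫θᵢ²|Φ|²` by the hypothesis
(valid for every `t`, fed with the weighted gap); the weights `∫θᵢ²|Φ|²` sum to `1`.
-/

noncomputable section

namespace Summit.AtomisticToContinuum.BoseEinsteinCondensation.Cruxes.StaticResponseBound.FewBody5

open MeasureTheory Filter
open scoped ENNReal NNReal BigOperators
open Literature.MathematicalPhysics.QuantumManyBody.BoseGas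
open Summit.AtomisticToContinuum.BoseEinsteinCondensation.Theses
open Summit.AtomisticToContinuum.BoseEinsteinCondensation.Theses.BECInsertionCorrector
open Summit.AtomisticToContinuum.BoseEinsteinCondensation.Theorems.StaticResponseBound.Negative
open Summit.AtomisticToContinuum.BoseEinsteinCondensation.Cruxes.StaticResponseBound.UvThomsonForceWave
open Summit.AtomisticToContinuum.BoseEinsteinCondensation.Cruxes.StaticResponseBound.FewBody

/-! ## Real arithmetic -/

/-- The quintic few-body bookkeeping: from `λ·L² ≤ 4π²/5` and `L > 0`: `5λ ≤ (2π/L)²`. [folklore] -/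
theorem a5_fewBody_bookkeeping {lam L : ℝ} (hL : 0 < L) (hE : lam * L ^ 2 ≤ 4 * Real.pi ^ 2 / 5) :
    5 * lam ≤ (2 * Real.pi / L) ^ 2 := by
  have hL2 : 0 < L ^ 2 := by positivity
  rw [show (2 * Real.pi / L) ^ 2 = (4 * Real.pi ^ 2) / L ^ 2 by field_simp; ring]
  rw [le_div_iff₀ hL2]
  linarith

/-! ## The assembly -/

/-- **Registered stub `stub_fewBodyBounded5_of_allCouplingPT` (assembly of the seat-a1 layer): `FewBodyBounded5` from
`stub_allCouplingPT`** (text inlined as the hypothesis), the landed complex ground-state representation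
`stub_complexGsRep` and the landed weighted gap `stub_weightedGap`: for every BOUNDED admissible `w`, every `N`, `L > 0`
with `E₀(w,N,L)·L² ≤ 4π²/5`, every `k ≠ 0`, `t`, finite-energy `Ψ`: `E₀ − 14t²N/|p|² ≤ E_w(Ψ) + t⟨∑cos⟩_Ψ`.
See the file header for the proof. [cite: ReedSimonIV1978, §XII.2; Kato1966, VII §4] -/
theorem stub_fewBodyBounded5_of_allCouplingPT :
    (∀ (w : ℝ → ℝ≥0∞) (N : ℕ) (L : ℝ), 0 < L → Measurable w →
      ∀ Φ : PeriodicTrialState N L, (∀ X, Φ.ψ X = (‖Φ.ψ X‖ : ℂ)) → (∀ X, Φ.ψ X ≠ 0) →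
        periodicEnergy w Φ ≠ ⊤ →
        (∀ Ψ : PeriodicTrialState N L, periodicEnergy w Ψ ≠ ⊤ →
          (periodicEnergy w Φ).toReal ≤ (periodicEnergy w Ψ).toReal) →
        ∀ (k : Fin 3 → ℤ), k ≠ 0 → 0 < N → ∀ t : ℝ,
        (∀ η : Config N → ℝ, IsPeriodicTest L η →
          (∀ (σ : Equiv.Perm (Fin N)) (X : Config N), η (X ∘ σ) = η X) →
          (∫ X in cellN N L, η X * ‖Φ.ψ X‖ ^ 2) = 0 →
          ((2 * Real.pi / L) ^ 2 - 2 * (periodicEnergy w Φ).toReal) *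
              ∫ X in cellN N L, η X ^ 2 * ‖Φ.ψ X‖ ^ 2 ≤ dirichletFormW L (fun X => ‖Φ.ψ X‖) η η) →
        0 ≤ t * cosMean L k Φ →
        5 * (periodicEnergy w Φ).toReal ≤ (2 * Real.pi / L) ^ 2 →
        ∀ θ : Config N → ℝ, IsPeriodicTest L θ →
          (∀ (σ : Equiv.Perm (Fin N)) (X : Config N), θ (X ∘ σ) = θ X) →
          -(14 * t ^ 2 * N / psq L k) * ∫ X in cellN N L, θ X ^ 2 * ‖Φ.ψ X‖ ^ 2 ≤
            dirichletFormW L (fun X => ‖Φ.ψ X‖) θ θ +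
              t * ∫ X in cellN N L,
                (∑ j, Real.cos (2 * Real.pi / L * ∑ i, (k i : ℝ) * X j i)) * θ X ^ 2 * ‖Φ.ψ X‖ ^ 2) →
    ∀ w : ℝ → ℝ≥0∞, IsRepulsiveFiniteRange w → (∃ M : ℝ≥0∞, M ≠ ⊤ ∧ ∀ r, w r ≤ M) →
      ∀ (N : ℕ) (L : ℝ), 0 < L →
        (periodicGroundStateEnergy w N L).toReal * L ^ 2 ≤ 4 * Real.pi ^ 2 / 5 →
        ∀ (k : Fin 3 → ℤ), k ≠ 0 → ∀ (t : ℝ) (Ψ : PeriodicTrialState N L), periodicEnergy w Ψ ≠ ⊤ →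
          (periodicGroundStateEnergy w N L).toReal - 14 * t ^ 2 * N / psq L k
            ≤ (periodicEnergy w Ψ).toReal + t * cosMean L k Ψ := by
  intro hPT w hw hM N L hL hE k hk t Ψ hΨ
  rcases Nat.eq_zero_or_pos N with hN0 | hNpos
  · -- `N = 0`: no particles, `⟨V⟩ = 0` and `E₀ ≤ E_w(Ψ)`
    subst hN0
    have hcos : cosMean L k Ψ = 0 := by
      unfold cosMean
      simp
    have h0 : (periodicGroundStateEnergy w 0 L).toReal ≤ (periodicEnergy w Ψ).toReal :=
      ENNReal.toReal_mono hΨ (periodicGroundStateEnergy_le w Ψ)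
    rw [hcos]
    simpa using h0
  obtain ⟨n, rfl⟩ : ∃ n, N = n + 1 := ⟨N - 1, by omega⟩
  -- the positive ground state with `t⟨V⟩ ≥ 0`
  obtain ⟨Φ, hEΦ, hfin, hreal, hpos, hsign⟩ : ∃ Φ : PeriodicTrialState (n + 1) L,
      periodicEnergy w Φ = periodicGroundStateEnergy w (n + 1) L ∧ periodicEnergy w Φ ≠ ⊤ ∧
        (∀ X, Φ.ψ X = (‖Φ.ψ X‖ : ℂ)) ∧ (∀ X, Φ.ψ X ≠ 0) ∧ 0 ≤ t * cosMean L k Φ := by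
    obtain ⟨Φ₀, hE0, hfin0, hreal0, hpos0⟩ :=
      Summit.AtomisticToContinuum.BoseEinsteinCondensation.Cruxes.HardCoreExtension.ThirdLawCurrentFloor.boundedPositiveMinimiser_holds
        hw hM n hL
    by_cases hs : 0 ≤ t * cosMean L k Φ₀
    · exact ⟨Φ₀, hE0, hfin0, hreal0, hpos0, hs⟩
    · obtain ⟨Φ₁, ⟨T, hT⟩, hEeq, hcos⟩ := exists_translate_cosMean_eq_neg hL hk Φ₀
      refine ⟨Φ₁, ?_, ?_, ?_, ?_, ?_⟩
      · rw [hEeq w, hE0]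
      · rw [hEeq w]; exact hfin0
      · intro X; simp only [hT]; exact hreal0 _
      · intro X; simp only [hT]; exact hpos0 _
      · rw [hcos]
        push Not at hs
        nlinarith
  set lam : ℝ := (periodicEnergy w Φ).toReal with hlamdef
  have hlamE : (periodicGroundStateEnergy w (n + 1) L).toReal = lam := by rw [hlamdef, hEΦ]
  have hmin : ∀ Ψ' : PeriodicTrialState (n + 1) L, periodicEnergy w Ψ' ≠ ⊤ →
      (periodicEnergy w Φ).toReal ≤ (periodicEnergy w Ψ').toReal := fun Ψ' h' => by
    rw [hEΦ]; exact ENNReal.toReal_mono h' (periodicGroundStateEnergy_le w Ψ')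
  -- few-body bookkeeping: `5λ ≤ (2π/L)²`
  rw [hlamE] at hE
  have hlam5 : 5 * lam ≤ (2 * Real.pi / L) ^ 2 := a5_fewBody_bookkeeping hL hE
  rw [hlamE]
  -- second-order perturbation theory (all couplings) for the two real components
  obtain ⟨⟨hθ₁, hθ₂⟩, ⟨hs₁, hs₂⟩, hnorm, hcosΨ, hener⟩ :=
    stub_complexGsRep w hw.1 (n + 1) L hL Φ hreal hpos hfin hmin Ψ hΨ
  have hgapΦ := stub_weightedGap w hw.1 (n + 1) L hL Φ hreal hpos hfin hmin
  have h1 := hPT w (n + 1) L hL hw.1 Φ hreal hpos hfin hmin k hk (Nat.succ_pos n) t hgapΦ hsign hlam5 _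
    hθ₁ hs₁
  have h2 := hPT w (n + 1) L hL hw.1 Φ hreal hpos hfin hmin k hk (Nat.succ_pos n) t hgapΦ hsign hlam5 _
    hθ₂ hs₂
  -- notation for the two components
  set θ₁ : Config (n + 1) → ℝ := fun X => (Ψ.ψ X).re / ‖Φ.ψ X‖ with hθ₁def
  set θ₂ : Config (n + 1) → ℝ := fun X => (Ψ.ψ X).im / ‖Φ.ψ X‖ with hθ₂def
  set V : Config (n + 1) → ℝ := fun X => ∑ j, Real.cos (2 * Real.pi / L * ∑ i, (k i : ℝ) * X j i)
    with hVdef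
  have hFc : Continuous fun X => ‖Φ.ψ X‖ := (contDiff_norm_of_real Φ hreal).continuous
  have hF2c : Continuous fun X => ‖Φ.ψ X‖ ^ 2 := hFc.pow 2
  have hθ₁c : Continuous θ₁ := hθ₁.continuous
  have hθ₂c : Continuous θ₂ := hθ₂.continuous
  have hVc : Continuous V := by
    simp only [hVdef]
    fun_prop
  -- split the normalisation and the density-wave mean into the two components
  have iM₁ : IntegrableOn (fun X => θ₁ X ^ 2 * ‖Φ.ψ X‖ ^ 2) (cellN (n + 1) L) :=
    integrableOn_cellN ((hθ₁c.pow 2).mul hF2c) L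
  have iM₂ : IntegrableOn (fun X => θ₂ X ^ 2 * ‖Φ.ψ X‖ ^ 2) (cellN (n + 1) L) :=
    integrableOn_cellN ((hθ₂c.pow 2).mul hF2c) L
  have iV₁ : IntegrableOn (fun X => V X * θ₁ X ^ 2 * ‖Φ.ψ X‖ ^ 2) (cellN (n + 1) L) :=
    integrableOn_cellN ((hVc.mul (hθ₁c.pow 2)).mul hF2c) L
  have iV₂ : IntegrableOn (fun X => V X * θ₂ X ^ 2 * ‖Φ.ψ X‖ ^ 2) (cellN (n + 1) L) :=
    integrableOn_cellN ((hVc.mul (hθ₂c.pow 2)).mul hF2c) L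
  have hmsum : (∫ X in cellN (n + 1) L, θ₁ X ^ 2 * ‖Φ.ψ X‖ ^ 2) +
      (∫ X in cellN (n + 1) L, θ₂ X ^ 2 * ‖Φ.ψ X‖ ^ 2) = 1 := by
    rw [← integral_add iM₁ iM₂, ← hnorm]
    refine integral_congr_ae (ae_of_all _ fun X => ?_)
    simp only [hθ₁def, hθ₂def]
    ring
  have hVsum : cosMean L k Ψ = (∫ X in cellN (n + 1) L, V X * θ₁ X ^ 2 * ‖Φ.ψ X‖ ^ 2) +
      ∫ X in cellN (n + 1) L, V X * θ₂ X ^ 2 * ‖Φ.ψ X‖ ^ 2 := by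
    rw [hcosΨ k, ← integral_add iV₁ iV₂]
    refine integral_congr_ae (ae_of_all _ fun X => ?_)
    simp only [hθ₁def, hθ₂def, hVdef]
    ring
  rw [hener, hVsum]
  -- the two perturbative bounds, in linear form
  have h1' : -(14 * t ^ 2 * ((n + 1 : ℕ) : ℝ) / psq L k * ∫ X in cellN (n + 1) L, θ₁ X ^ 2 * ‖Φ.ψ X‖ ^ 2) ≤
      dirichletFormW L (fun X => ‖Φ.ψ X‖) θ₁ θ₁ +
        t * ∫ X in cellN (n + 1) L, V X * θ₁ X ^ 2 * ‖Φ.ψ X‖ ^ 2 := by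
    have := h1
    rwa [neg_mul] at this
  have h2' : -(14 * t ^ 2 * ((n + 1 : ℕ) : ℝ) / psq L k * ∫ X in cellN (n + 1) L, θ₂ X ^ 2 * ‖Φ.ψ X‖ ^ 2) ≤
      dirichletFormW L (fun X => ‖Φ.ψ X‖) θ₂ θ₂ +
        t * ∫ X in cellN (n + 1) L, V X * θ₂ X ^ 2 * ‖Φ.ψ X‖ ^ 2 := by
    have := h2
    rwa [neg_mul] at this
  have hc : 14 * t ^ 2 * ((n + 1 : ℕ) : ℝ) / psq L k * (∫ X in cellN (n + 1) L, θ₁ X ^ 2 * ‖Φ.ψ X‖ ^ 2) +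
      14 * t ^ 2 * ((n + 1 : ℕ) : ℝ) / psq L k * (∫ X in cellN (n + 1) L, θ₂ X ^ 2 * ‖Φ.ψ X‖ ^ 2) =
      14 * t ^ 2 * ((n + 1 : ℕ) : ℝ) / psq L k := by
    rw [← mul_add, hmsum, mul_one]
  linarith

end Summit.AtomisticToContinuum.BoseEinsteinCondensation.Cruxes.StaticResponseBound.FewBody5

end
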